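import Mathlib.Analysis.Calculus.LocalExtr.Basic
import Mathlib.Analysis.Calculus.Deriv.Mul
import Mathlib.Topology.Order.Compact
import Mathlib.Analysis.Convex.Basic
import HarnessLib

/-!
# Sup-norm bounds for scalar transport `c P′ = β P − h` with damping `β ≥ ν₀ > 0`:
# the repulsive (outflow) point costs nothing

Topic `Literature/Analysis/ODE` (namespace `Literature.Analysis.ODE`). Elementary maximum-principle bounds for a
real scalar first-order linear equation `c(x) P′(x) = β(x) P(x) − h(x)` on a compact interval `[x₁, x₂]`, where the
"damping" `β` is bounded below by `ν₀ > 0`, the speed `c` is ARBITRARY in the interior (it may vanish or change sign: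
a degenerate/sonic point), and only the SIGN OF `c` AT THE TWO ENDPOINTS matters:

* `repulsive_transport_trichotomy` — at a point `x⋆` where `|P|` is maximal on `[x₁, x₂]` one has `c P P′ ≤ 0`
  (interior: Fermat; endpoints: one-sided Fermat on the interval), UNLESS `x⋆` is an endpoint through which the
  characteristics ENTER (`x⋆ = x₁` with `c(x₁) < 0`, or `x⋆ = x₂` with `c(x₂) > 0`); in the first case the equation
  at `x⋆` gives `ν₀ P² ≤ β P² = h P + c P P′ ≤ |h| |P|`, i.e. `ν₀ sup |P| ≤ sup |h|`.
* `repulsive_transport_sup` — both endpoints are OUTFLOW (`c(x₁) ≥ 0`, `c(x₂) ≤ 0`; e.g. an interval around a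
  repulsive degenerate point `c(x) ≈ −κ x`, `κ > 0`): `ν₀ |P(x)| ≤ sup |h|` on the whole interval — the forced smooth
  branch at a repulsive regular-singular point with NEGATIVE Frobenius exponent `−β/κ` obeys the sup bound with the
  gain `1/ν₀` and NO loss of derivatives (the integral form is `P = T h`, `(T h)(x) = ∫₀¹ u^{ν₀/κ − 1} h(xu) du/κ`).
* `transport_sup_of_outflow_right` / `transport_sup_of_outflow_left` — one inflow endpoint: the bound is
  `max (sup |h|) (ν₀ |P(inflow endpoint)|)`.

These are the sup-norm (weighted `C⁰ → C⁰`) estimates for the degenerate characteristic field at the repulsive sonic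
point of self-similar Euler implosion profiles when the spectral parameter is beyond the order-zero coefficient
(Chen–Shkoller–Vicol, arXiv:2605.00808, §1.10: smoothness is forced and free at a repulsive sonic point), and the
plain damped-transport bounds elsewhere. Everything here is folklore (Fermat's theorem on a compact interval).

## References

* P. Hartman, *Ordinary Differential Equations*, 2nd ed., SIAM 2002, Ch. III (differential inequalities; the
  one-sided endpoint argument is the scalar maximum principle). Key `Hartman2002`.
* J. Chen, S. Shkoller, V. Vicol, *Smooth and stable Euler implosions*, arXiv:2605.00808, §1.10. Key
  `ChenShkollerVicol2026`.
-/

noncomputable section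

open Set Filter Topology

namespace Literature.Analysis.ODE


/-- **Trichotomy at the maximum of `|P|`.** For `c P′ = β P − h` on `[x₁, x₂]` with `β ≥ ν₀ > 0` and `|h| ≤ H`:
either `ν₀ |P| ≤ H` on the whole interval, or `|P|` is dominated by its value at an INFLOW endpoint
(`x₁` with `c(x₁) < 0`, or `x₂` with `c(x₂) > 0`). At a maximum point `x⋆` of `P²` that is interior (Fermat) or an
endpoint with the outflow sign (one-sided Fermat, `IsLocalMaxOn.hasFDerivWithinAt_nonpos`), `c P P′ ≤ 0`, so the
equation gives `ν₀ P² ≤ β P² = hP + cPP′ ≤ H|P|`. [cite: Hartman2002, Ch. III] -/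
theorem repulsive_transport_trichotomy {c β h P P' : ℝ → ℝ} {x₁ x₂ ν₀ H : ℝ} (hx : x₁ ≤ x₂) (hν : 0 < ν₀)
    (hP : ∀ x ∈ Icc x₁ x₂, HasDerivWithinAt P (P' x) (Icc x₁ x₂) x)
    (hode : ∀ x ∈ Icc x₁ x₂, c x * P' x = β x * P x - h x)
    (hβ : ∀ x ∈ Icc x₁ x₂, ν₀ ≤ β x) (hh : ∀ x ∈ Icc x₁ x₂, |h x| ≤ H) :
    (∀ x ∈ Icc x₁ x₂, ν₀ * |P x| ≤ H) ∨ (c x₁ < 0 ∧ ∀ x ∈ Icc x₁ x₂, |P x| ≤ |P x₁|) ∨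
      (0 < c x₂ ∧ ∀ x ∈ Icc x₁ x₂, |P x| ≤ |P x₂|) := by
  -- the square `Q = P²` attains its maximum on the compact interval at some `x⋆`
  set Q : ℝ → ℝ := fun x => P x * P x with hQ
  have hQc : ContinuousOn Q (Icc x₁ x₂) := fun x hx =>
    (hP x hx).continuousWithinAt.mul (hP x hx).continuousWithinAt
  obtain ⟨xs, hxs, hmax⟩ := (isCompact_Icc : IsCompact (Icc x₁ x₂)).exists_isMaxOn (nonempty_Icc.2 hx) hQc
  have hQd : HasDerivWithinAt Q (P' xs * P xs + P xs * P' xs) (Icc x₁ x₂) xs := (hP xs hxs).mul (hP xs hxs)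
  have hdom : ∀ x ∈ Icc x₁ x₂, |P x| ≤ |P xs| := fun x hx => by
    have h1 : P x * P x ≤ P xs * P xs := (isMaxOn_iff.1 hmax) x hx
    exact abs_le_of_sq_le_sq (by rw [sq_abs]; nlinarith) (abs_nonneg _)
  -- if `c(x⋆) P(x⋆) P'(x⋆) ≤ 0` the equation at `x⋆` bounds the maximum
  have conclude : c xs * (P xs * P' xs) ≤ 0 → ∀ x ∈ Icc x₁ x₂, ν₀ * |P x| ≤ H := by
    intro hs x hx
    have e := hode xs hxs
    have hb := hβ xs hxs
    have hhx := hh xs hxs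
    have h0 : c xs * (P xs * P' xs) = β xs * (P xs * P xs) - h xs * P xs := by
      rw [mul_left_comm, e]; ring
    have h2 : ν₀ * (P xs * P xs) ≤ H * |P xs| :=
      calc ν₀ * (P xs * P xs) ≤ β xs * (P xs * P xs) := mul_le_mul_of_nonneg_right hb (mul_self_nonneg _)
        _ ≤ h xs * P xs := by linarith
        _ ≤ |h xs * P xs| := le_abs_self _
        _ = |h xs| * |P xs| := abs_mul _ _
        _ ≤ H * |P xs| := mul_le_mul_of_nonneg_right hhx (abs_nonneg _)
    have h3 : ν₀ * |P xs| ≤ H := by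
      rcases eq_or_ne (P xs) 0 with hz | hz
      · rw [hz, abs_zero, mul_zero]; exact le_trans (abs_nonneg _) hhx
      · have hpos : 0 < |P xs| := abs_pos.2 hz
        have h4 : ν₀ * |P xs| * |P xs| ≤ H * |P xs| := by rw [mul_assoc, abs_mul_abs_self]; exact h2
        exact le_of_mul_le_mul_right h4 hpos
    calc ν₀ * |P x| ≤ ν₀ * |P xs| := mul_le_mul_of_nonneg_left (hdom x hx) hν.le
      _ ≤ H := h3
  have hloc : IsLocalMaxOn Q (Icc x₁ x₂) xs := hmax.localize
  -- position of `x⋆`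
  rcases eq_or_lt_of_le hxs.1 with h1 | h1
  · -- `x⋆ = x₁`
    subst h1
    rcases eq_or_lt_of_le hx with h12 | h12
    · -- degenerate interval
      subst h12
      rcases lt_trichotomy (c x₁) 0 with hc | hc | hc
      · exact Or.inr (Or.inl ⟨hc, hdom⟩)
      · exact Or.inl (conclude (by rw [hc, zero_mul]))
      · exact Or.inr (Or.inr ⟨hc, hdom⟩)
    · have hy : x₂ - x₁ ∈ posTangentConeAt (Icc x₁ x₂) x₁ :=
        sub_mem_posTangentConeAt_of_segment_subset
          ((convex_Icc x₁ x₂).segment_subset (left_mem_Icc.2 hx) (right_mem_Icc.2 hx))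
      have hF := hloc.hasFDerivWithinAt_nonpos hQd.hasFDerivWithinAt hy
      simp only [ContinuousLinearMap.toSpanSingleton_apply, smul_eq_mul] at hF
      have hQ' : P x₁ * P' x₁ ≤ 0 := by nlinarith
      rcases le_or_gt 0 (c x₁) with hc | hc
      · exact Or.inl (conclude (mul_nonpos_of_nonneg_of_nonpos hc hQ'))
      · exact Or.inr (Or.inl ⟨hc, hdom⟩)
  · rcases eq_or_lt_of_le hxs.2 with h2 | h2
    · -- `x⋆ = x₂`
      subst h2
      have hy : x₁ - xs ∈ posTangentConeAt (Icc x₁ xs) xs :=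
        sub_mem_posTangentConeAt_of_segment_subset
          ((convex_Icc x₁ xs).segment_subset (right_mem_Icc.2 hx) (left_mem_Icc.2 hx))
      have hF := hloc.hasFDerivWithinAt_nonpos hQd.hasFDerivWithinAt hy
      simp only [ContinuousLinearMap.toSpanSingleton_apply, smul_eq_mul] at hF
      have hQ' : 0 ≤ P xs * P' xs := by nlinarith
      rcases le_or_gt (c xs) 0 with hc | hc
      · exact Or.inl (conclude (mul_nonpos_of_nonpos_of_nonneg hc hQ'))
      · exact Or.inr (Or.inr ⟨hc, hdom⟩)
    · -- interior point: Fermat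
      have hn : Icc x₁ x₂ ∈ 𝓝 xs := Icc_mem_nhds h1 h2
      have hzero := (hmax.isLocalMax hn).hasDerivAt_eq_zero (hQd.hasDerivAt hn)
      have hPP : P xs * P' xs = 0 := by linarith
      exact Or.inl (conclude (by rw [hPP, mul_zero]))

/-- **Sup bound through a repulsive (two-sided outflow) point.** If `c(x₁) ≥ 0` and `c(x₂) ≤ 0` (characteristics
leave `[x₁, x₂]` through both ends, as around a repulsive sonic point `c ≈ −κx`), every differentiable solution of
`c P′ = β P − h` with `β ≥ ν₀ > 0`, `|h| ≤ H` satisfies `ν₀ |P| ≤ H` on `[x₁, x₂]`: the gain `1/ν₀` with no loss of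
derivatives and no boundary data. [cite: Hartman2002, Ch. III] -/
theorem repulsive_transport_sup {c β h P P' : ℝ → ℝ} {x₁ x₂ ν₀ H : ℝ} (hx : x₁ ≤ x₂) (hν : 0 < ν₀)
    (hP : ∀ x ∈ Icc x₁ x₂, HasDerivWithinAt P (P' x) (Icc x₁ x₂) x)
    (hode : ∀ x ∈ Icc x₁ x₂, c x * P' x = β x * P x - h x)
    (hβ : ∀ x ∈ Icc x₁ x₂, ν₀ ≤ β x) (hh : ∀ x ∈ Icc x₁ x₂, |h x| ≤ H) (hc₁ : 0 ≤ c x₁) (hc₂ : c x₂ ≤ 0) :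
    ∀ x ∈ Icc x₁ x₂, ν₀ * |P x| ≤ H := by
  rcases repulsive_transport_trichotomy hx hν hP hode hβ hh with h0 | ⟨h1, -⟩ | ⟨h2, -⟩
  · exact h0
  · exact absurd h1 (not_lt.2 hc₁)
  · exact absurd h2 (not_lt.2 hc₂)

/-- **Damped transport with inflow at the left end.** If `c(x₂) ≤ 0` (outflow or characteristic at the right end),
then `ν₀ |P| ≤ max H (ν₀ |P(x₁)|)` on `[x₁, x₂]`. [cite: Hartman2002, Ch. III] -/
theorem transport_sup_of_outflow_right {c β h P P' : ℝ → ℝ} {x₁ x₂ ν₀ H : ℝ} (hx : x₁ ≤ x₂) (hν : 0 < ν₀)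
    (hP : ∀ x ∈ Icc x₁ x₂, HasDerivWithinAt P (P' x) (Icc x₁ x₂) x)
    (hode : ∀ x ∈ Icc x₁ x₂, c x * P' x = β x * P x - h x)
    (hβ : ∀ x ∈ Icc x₁ x₂, ν₀ ≤ β x) (hh : ∀ x ∈ Icc x₁ x₂, |h x| ≤ H) (hc₂ : c x₂ ≤ 0) :
    ∀ x ∈ Icc x₁ x₂, ν₀ * |P x| ≤ max H (ν₀ * |P x₁|) := by
  rcases repulsive_transport_trichotomy hx hν hP hode hβ hh with h0 | ⟨-, h1⟩ | ⟨h2, -⟩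
  · exact fun x hx => (h0 x hx).trans (le_max_left _ _)
  · exact fun x hx => (mul_le_mul_of_nonneg_left (h1 x hx) hν.le).trans (le_max_right _ _)
  · exact absurd h2 (not_lt.2 hc₂)

/-- **Damped transport with inflow at the right end.** If `c(x₁) ≥ 0`, then `ν₀ |P| ≤ max H (ν₀ |P(x₂)|)` on
`[x₁, x₂]`. [cite: Hartman2002, Ch. III] -/
theorem transport_sup_of_outflow_left {c β h P P' : ℝ → ℝ} {x₁ x₂ ν₀ H : ℝ} (hx : x₁ ≤ x₂) (hν : 0 < ν₀)
    (hP : ∀ x ∈ Icc x₁ x₂, HasDerivWithinAt P (P' x) (Icc x₁ x₂) x)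
    (hode : ∀ x ∈ Icc x₁ x₂, c x * P' x = β x * P x - h x)
    (hβ : ∀ x ∈ Icc x₁ x₂, ν₀ ≤ β x) (hh : ∀ x ∈ Icc x₁ x₂, |h x| ≤ H) (hc₁ : 0 ≤ c x₁) :
    ∀ x ∈ Icc x₁ x₂, ν₀ * |P x| ≤ max H (ν₀ * |P x₂|) := by
  rcases repulsive_transport_trichotomy hx hν hP hode hβ hh with h0 | ⟨h1, -⟩ | ⟨-, h2⟩
  · exact fun x hx => (h0 x hx).trans (le_max_left _ _)
  · exact absurd h1 (not_lt.2 hc₁)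
  · exact fun x hx => (mul_le_mul_of_nonneg_left (h2 x hx) hν.le).trans (le_max_right _ _)

end Literature.Analysis.ODE

end
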